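import Mathlib
import Summits.Ventures.PercRepro.PuncturedLYMUnif33Table
import Summits.Ventures.PercRepro.PuncturedLYMUnif33Rows1

/-!
# PercRepro — (SP) FOR ANY NUMBER OF PAIRWISE DISJOINT `3`-SETS AT LEVEL `3`: THE ROW IDENTITIES, ASSEMBLED
(p10, gen 40)

`row_check`: the row identity of every class with `Σ v c_v ≤ 3`, by `interval_cases` over the class counts.  Nothing here asserts (SP).
-/

namespace PercRepro.PuncturedLYM.Split.TypeLift.Unif33

/-- The row identity of every class, in one statement. -/
theorem row_check (n k : ℚ) (hQ : Qp n k ≠ 0) (hP : Pp n k ≠ 0) (hPc : Pc n k ≠ 0) (c1 c2 : ℕ)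
    (h : c1 + 2 * c2 ≤ 3) :
    3 * (k - ((c1 : ℚ) + c2)) * raw n k c1 c2 0 + 2 * (c1 : ℚ) * raw n k c1 c2 1 + (c2 : ℚ) / 3 +
      (n - 3 * k - ((3 : ℚ) - c1 - 2 * c2)) * raw n k c1 c2 3 = Yc n / Pc n k := by
  have hb1 : c1 ≤ 3 := by omega
  have hb2 : c2 ≤ 1 := by omega
  interval_cases c1 <;> interval_cases c2 <;> push_cast
  · linear_combination row_00 n k hQ hP hPc
  · linear_combination row_01 n k hQ hP hPc
  · linear_combination row_10 n k hQ hP hPc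
  · linear_combination row_11 n k hQ hP hPc
  · linear_combination row_20 n k hQ hP hPc
  · omega
  · linear_combination row_30 n k hQ hP hPc
  · omega

end PercRepro.PuncturedLYM.Split.TypeLift.Unif33
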